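import Literature.NumberTheory.LFunctions.DirichletLTruncationPacked
import HarnessLib

/-!
# Packed truncation certificates — the leaf statistics

For `0/1` digit vectors `Dp = kpack b L d⁺`, `Dm = kpack b L d⁻` (`b ≥ 16`, `1 ≤ L < 2^{12}`) the fields of
`LTruncationPacked.leafData` are the intended statistics: `cp = Σ d⁺`, `cm = Σ d⁻`, `mm = Σ t·d⁻_t`,
`mL = Σ_{t ≤ t_m} (t_m − t) d⁺_t`, `mR = Σ_{t > t_m} (t − t_m) d⁺_t` (`t_m = ⌊(L−1)/2⌋`), and `Cp, Cm` are the packed prefix counts.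
[cite: Chua2005RealZeros, §2.2 ALGO 1] [cite: GathenGerhard2013ModernComputerAlgebra, §8.4 (Kronecker substitution)]
-/

namespace Literature.NumberTheory.LFunctions

namespace LTruncationPacked

open Finset FeketePolyaKernel LTruncationCert Literature.Analysis.Convolution

section LeafStats

variable {b L : ℕ} {dP dM : ℕ → ℕ}

/-- A sum of at most `L` digits `≤ 1` is `< 2^b − 1` when `L < 2^{12} ≤ 2^b/16`. [folklore] -/
private theorem sum_ind_lt (hb : 16 ≤ b) (hL : L < 2 ^ 12) (hd : ∀ j < L, dP j ≤ 1) :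
    ∑ j ∈ range L, dP j < 2 ^ b - 1 := by
  have h1 : ∑ j ∈ range L, dP j ≤ L := by
    calc ∑ j ∈ range L, dP j ≤ ∑ _j ∈ range L, 1 := Finset.sum_le_sum fun j hj => hd j (Finset.mem_range.1 hj)
      _ = L := by simp
  have h2 : 2 ^ 12 ≤ 2 ^ b / 2 := by
    rw [Nat.le_div_iff_mul_le (by norm_num), ← pow_succ]
    exact Nat.pow_le_pow_right (by norm_num) (by omega)
  have h3 : 1 ≤ 2 ^ b / 2 := le_trans (by norm_num) h2
  omega

/-- A weighted sum `Σ t·d_t` (`t < L < 2^{12}`, `d_t ≤ 1`) is `< 2^b − 1` for `b ≥ 16`… generously: `< 2^{24} ≤ 2^b − 1` needs `b ≥ 25`;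
we only use `L·L`-type bounds with `b ≥ 16 + 12`. To stay with `b ≥ 16` we bound by `L · 2^{12} ≤ 2^{24}` and require `28 ≤ b`. [folklore] -/
private theorem sum_wt_lt (hb : 28 ≤ b) (hL : L < 2 ^ 12) {w : ℕ → ℕ} (hw : ∀ j < L, w j ≤ 2 ^ 12) (hd : ∀ j < L, dP j ≤ 1) :
    ∑ j ∈ range L, w j * dP j < 2 ^ b - 1 := by
  have h1 : ∑ j ∈ range L, w j * dP j ≤ L * 2 ^ 12 := by
    calc ∑ j ∈ range L, w j * dP j ≤ ∑ _j ∈ range L, 2 ^ 12 := Finset.sum_le_sum fun j hj => by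
            have hj' := Finset.mem_range.1 hj
            calc w j * dP j ≤ 2 ^ 12 * 1 := Nat.mul_le_mul (hw j hj') (hd j hj')
              _ = 2 ^ 12 := mul_one _
      _ = L * 2 ^ 12 := by simp
  have h2 : L * 2 ^ 12 < 2 ^ 24 := by
    calc L * 2 ^ 12 < 2 ^ 12 * 2 ^ 12 := Nat.mul_lt_mul_of_pos_right hL (by positivity)
      _ = 2 ^ 24 := by norm_num
  have h3 : 2 ^ 24 ≤ 2 ^ b / 2 := by
    rw [Nat.le_div_iff_mul_le (by norm_num), ← pow_succ]
    exact Nat.pow_le_pow_right (by norm_num) (by omega)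
  omega

/-- `cp = Σ d⁺`. [cite: Chua2005RealZeros, §2.2 ALGO 1] -/
theorem leafData_cp (hb : 16 ≤ b) (hL : L < 2 ^ 12) (hd : ∀ j < L, dP j ≤ 1) (P J n0 Dm : ℕ) :
    (leafData b P J n0 L (kpack b L dP) Dm).cp = ∑ j ∈ range L, dP j := by
  simp only [leafData]
  exact dsum_kpack (sum_ind_lt hb hL hd)

/-- `cm = Σ d⁻`. [cite: Chua2005RealZeros, §2.2 ALGO 1] -/
theorem leafData_cm (hb : 16 ≤ b) (hL : L < 2 ^ 12) (hd : ∀ j < L, dM j ≤ 1) (P J n0 Dp : ℕ) :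
    (leafData b P J n0 L Dp (kpack b L dM)).cm = ∑ j ∈ range L, dM j := by
  simp only [leafData]
  exact dsum_kpack (sum_ind_lt hb hL hd)

/-- `Cp` = packed prefix counts of `d⁺`. [cite: Chua2005RealZeros, §2.2 ALGO 1] -/
theorem leafData_Cp (hb : 16 ≤ b) (hL : L < 2 ^ 12) (hd : ∀ j < L, dP j ≤ 1) (P J n0 Dm : ℕ) :
    (leafData b P J n0 L (kpack b L dP) Dm).Cp = kpack b L (psumF dP) := by
  simp only [leafData, Nat.one_shiftLeft]
  have hs : ∑ i ∈ range L, dP i < 2 ^ b := lt_of_lt_of_le (sum_ind_lt hb hL hd) (Nat.sub_le _ _)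
  exact kpack_mul_onesV_low (by omega) hs

/-- `Cm` = packed prefix counts of `d⁻`. [cite: Chua2005RealZeros, §2.2 ALGO 1] -/
theorem leafData_Cm (hb : 16 ≤ b) (hL : L < 2 ^ 12) (hd : ∀ j < L, dM j ≤ 1) (P J n0 Dp : ℕ) :
    (leafData b P J n0 L Dp (kpack b L dM)).Cm = kpack b L (psumF dM) := by
  simp only [leafData, Nat.one_shiftLeft]
  have hs : ∑ i ∈ range L, dM i < 2 ^ b := lt_of_lt_of_le (sum_ind_lt hb hL hd) (Nat.sub_le _ _)
  exact kpack_mul_onesV_low (by omega) hs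

/-- `mm = Σ t·d⁻_t`. [cite: Chua2005RealZeros, §2.2 ALGO 1] -/
theorem leafData_mm (hb : 28 ≤ b) (hL : L < 2 ^ 12) (hd : ∀ j < L, dM j ≤ 1) (P J n0 Dp : ℕ) :
    (leafData b P J n0 L Dp (kpack b L dM)).mm = ∑ j ∈ range L, j * dM j := by
  have hb1 : 1 ≤ b := by omega
  have hLb : L < 2 ^ b := lt_of_lt_of_le hL (Nat.pow_le_pow_right (by norm_num) (by omega))
  simp only [leafData, Nat.one_shiftLeft]
  rw [rampV_eq hb1 hLb, kpack_land_indMask hb1 (fun j hj => lt_trans hj hLb) hd]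
  exact dsum_kpack (sum_wt_lt hb hL (fun j hj => (le_of_lt (lt_trans hj hL))) hd)

/-- The left ramp `JL`: digits `t_m − t` for `t ≤ t_m`, then zeros. [folklore] -/
private theorem JL_eq {tm r : ℕ} (hb1 : 1 ≤ b) (hdig : tm + 1 + r < 2 ^ b) :
    tm * onesV b (tm + 1) - (kpack b (tm + 1 + r) (fun t => t) &&& (2 ^ (b * (tm + 1)) - 1)) =
      kpack b (tm + 1 + r) fun j => if j ≤ tm then tm - j else 0 := by
  rw [kpack_land_low (by omega : tm + 1 ≤ tm + 1 + r) (fun j hj => by omega), onesV_eq_kpack hb1, kpack_smul,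
    kpack_tsub (fun j hj => by simp only [mul_one]; omega)]
  symm
  refine kpack_extend (fun j hj => ?_) (fun j hj1 hj2 => ?_)
  · simp [show j ≤ tm by omega]
  · simp [show ¬ j ≤ tm by omega]

/-- The right ramp `JR`: digits `u + 1` (`u < r`). [folklore] -/
private theorem JR_eq {tm r : ℕ} (hb1 : 1 ≤ b) (hdig : tm + 1 + r < 2 ^ b) :
    (kpack b (tm + 1 + r) (fun t => t) >>> (b * (tm + 1))) - tm * onesV b r = kpack b r fun u => u + 1 := by
  rw [kpack_shiftRight_high (fun j hj => by omega), onesV_eq_kpack hb1, kpack_smul,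
    kpack_tsub (fun j _ => by simp only [mul_one]; omega)]
  exact kpack_congr fun j _ => by simp only [mul_one]; omega

/-- `mL = Σ_{t ≤ t_m} (t_m − t)·d⁺_t`, `t_m = ⌊(L−1)/2⌋`. [cite: Chua2005RealZeros, §2.2 ALGO 1] -/
theorem leafData_mL (hb : 28 ≤ b) (hL : L < 2 ^ 12) (hL1 : 1 ≤ L) (hd : ∀ j < L, dP j ≤ 1) (P J n0 Dm : ℕ) :
    (leafData b P J n0 L (kpack b L dP) Dm).mL =
      ∑ j ∈ range L, (if j ≤ (L - 1) / 2 then (L - 1) / 2 - j else 0) * dP j := by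
  have hb1 : 1 ≤ b := by omega
  have hLb : L < 2 ^ b := lt_of_lt_of_le hL (Nat.pow_le_pow_right (by norm_num) (by omega))
  simp only [leafData, Nat.one_shiftLeft]
  rw [rampV_eq hb1 hLb]
  obtain ⟨r, hr⟩ : ∃ r, L = (L - 1) / 2 + 1 + r := ⟨L - ((L - 1) / 2 + 1), by omega⟩
  generalize htm : (L - 1) / 2 = tm at hr ⊢
  subst hr
  rw [JL_eq hb1 hLb, kpack_land_indMask hb1 (fun j hj => ?_) hd]
  · exact dsum_kpack (sum_wt_lt hb hL (fun j hj => by split_ifs <;> omega) hd)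
  · split_ifs <;> omega

/-- `mR = Σ_{t > t_m} (t − t_m)·d⁺_t`. [cite: Chua2005RealZeros, §2.2 ALGO 1] -/
theorem leafData_mR (hb : 28 ≤ b) (hL : L < 2 ^ 12) (hL1 : 1 ≤ L) (hd : ∀ j < L, dP j ≤ 1) (P J n0 Dm : ℕ) :
    (leafData b P J n0 L (kpack b L dP) Dm).mR =
      ∑ j ∈ range L, (if (L - 1) / 2 < j then j - (L - 1) / 2 else 0) * dP j := by
  have hb1 : 1 ≤ b := by omega
  have hLb : L < 2 ^ b := lt_of_lt_of_le hL (Nat.pow_le_pow_right (by norm_num) (by omega))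
  have hdig1 : ∀ j < L, dP j < 2 ^ b := fun j hj => lt_of_le_of_lt (hd j hj) (by
    calc (1 : ℕ) < 2 ^ 1 := by norm_num
      _ ≤ 2 ^ b := Nat.pow_le_pow_right (by norm_num) hb1)
  simp only [leafData, Nat.one_shiftLeft]
  rw [rampV_eq hb1 hLb]
  obtain ⟨r, hr⟩ : ∃ r, L = (L - 1) / 2 + 1 + r := ⟨L - ((L - 1) / 2 + 1), by omega⟩
  generalize htm : (L - 1) / 2 = tm at hr ⊢
  subst hr
  rw [show tm + 1 + r - (tm + 1) = r by omega]
  have hDs : kpack b (tm + 1 + r) dP >>> (b * (tm + 1)) = kpack b r fun u => dP (tm + 1 + u) :=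
    kpack_shiftRight_high (fun j hj => hdig1 j (by omega))
  rw [JR_eq hb1 hLb, hDs, kpack_land_indMask hb1 (fun j hj => by omega) (fun j hj => hd _ (by omega))]
  rw [dsum_kpack]
  · -- reindex `u ↦ tm + 1 + u`
    rw [Finset.sum_range_add]
    have h0 : ∑ x ∈ range (tm + 1), (if tm < x then x - tm else 0) * dP x = 0 :=
      Finset.sum_eq_zero fun x hx => by
        rw [if_neg (by have := Finset.mem_range.1 hx; omega), zero_mul]
    rw [h0, zero_add]
    exact Finset.sum_congr rfl fun u _ => by
      rw [if_pos (by omega)]; congr 1; omega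
  · exact sum_wt_lt hb (by omega) (fun j hj => by omega) (fun j hj => hd _ (by omega))

end LeafStats

end LTruncationPacked

end Literature.NumberTheory.LFunctions
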